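import Summits.Ventures.PercRepro.C025Profile

/-!
# THE PROFILE PRICE IS INCREASING IN THE RANK OF THE COMPLEMENT (night-3 g23)

`proofs/NIGHT3-G23-SECONDROW.md` §5(a).  The price `C(p+q, u)/C(p+q, q)` of the row `(q, u)` (for `q ≤ u ≤ p`)
grows with `p`: `f(p+1) = f(p) · (p+1)/(p+q+1−u) ≥ f(p)`.  Hence the price of a set is at least `(u+1)/(q+1)` when
its complement has rank `≥ u+1` and at least `1` when it has rank `≥ u`, and a matroid whose complements have
smaller ranks has smaller prices (`price_le_price_of_eRk_le`; e.g. a truncation).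
* `choose_div_choose_le_succ`, `choose_div_choose_mono` — the binomial monotonicity;
* `price_eq_of_le`, `price_le_price_of_eRk_le`, `div_le_price_of_succ_le_eRk`, `one_le_price_of_le_eRk`.
No `def`, no `instance`, no notation.  Axioms: standard.
-/

open scoped Matroid

namespace PercRepro

open Set Finset ThmH

namespace PriceMono

/-- One step: for `q ≤ u`, `C(p+q, u)/C(p+q, q) ≤ C(p+1+q, u)/C(p+1+q, q)`. -/
theorem choose_div_choose_le_succ {p q u : ℕ} (hqu : q ≤ u) :
    ((p + q).choose u : ℚ) / ((p + q).choose q : ℚ) ≤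
      ((p + 1 + q).choose u : ℚ) / ((p + 1 + q).choose q : ℚ) := by
  have h1 := Nat.choose_mul_succ_eq (p + q) u
  have h2 := Nat.choose_mul_succ_eq (p + q) q
  have hpos1 : (0 : ℚ) < ((p + q).choose q : ℚ) := by exact_mod_cast Nat.choose_pos (by omega)
  have hpos2 : (0 : ℚ) < ((p + 1 + q).choose q : ℚ) := by exact_mod_cast Nat.choose_pos (by omega)
  rw [div_le_div_iff₀ hpos1 hpos2]
  -- `C(n,u)·C(n+1,q) ≤ C(n+1,u)·C(n,q)` with `n = p+q`: multiply both sides by `(n+1)` and use the two identities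
  have hn : (p + 1 + q) = p + q + 1 := by ring
  rw [hn]
  have key : ((p + q).choose u : ℚ) * ((p + q + 1).choose q : ℚ) * ((p + q + 1 : ℕ) : ℚ) ≤
      ((p + q + 1).choose u : ℚ) * ((p + q).choose q : ℚ) * ((p + q + 1 : ℕ) : ℚ) := by
    have e1 : ((p + q).choose u : ℚ) * ((p + q + 1 : ℕ) : ℚ) =
        ((p + q + 1).choose u : ℚ) * ((p + q + 1 - u : ℕ) : ℚ) := by exact_mod_cast h1
    have e2 : ((p + q).choose q : ℚ) * ((p + q + 1 : ℕ) : ℚ) =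
        ((p + q + 1).choose q : ℚ) * ((p + q + 1 - q : ℕ) : ℚ) := by exact_mod_cast h2
    calc ((p + q).choose u : ℚ) * ((p + q + 1).choose q : ℚ) * ((p + q + 1 : ℕ) : ℚ)
        = ((p + q + 1).choose q : ℚ) * (((p + q).choose u : ℚ) * ((p + q + 1 : ℕ) : ℚ)) := by ring
      _ = ((p + q + 1).choose q : ℚ) * (((p + q + 1).choose u : ℚ) * ((p + q + 1 - u : ℕ) : ℚ)) := by rw [e1]
      _ ≤ ((p + q + 1).choose u : ℚ) * (((p + q + 1).choose q : ℚ) * ((p + q + 1 - q : ℕ) : ℚ)) := by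
          have : ((p + q + 1 - u : ℕ) : ℚ) ≤ ((p + q + 1 - q : ℕ) : ℚ) := by exact_mod_cast (by omega : p + q + 1 - u ≤ p + q + 1 - q)
          have hu0 : (0 : ℚ) ≤ ((p + q + 1).choose u : ℚ) := by positivity
          have hq0 : (0 : ℚ) ≤ ((p + q + 1).choose q : ℚ) := by positivity
          nlinarith [mul_le_mul_of_nonneg_left this (mul_nonneg hu0 hq0)]
      _ = ((p + q + 1).choose u : ℚ) * (((p + q).choose q : ℚ) * ((p + q + 1 : ℕ) : ℚ)) := by rw [e2]
      _ = ((p + q + 1).choose u : ℚ) * ((p + q).choose q : ℚ) * ((p + q + 1 : ℕ) : ℚ) := by ring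
  have hpos : (0 : ℚ) < ((p + q + 1 : ℕ) : ℚ) := by positivity
  exact le_of_mul_le_mul_right key hpos

/-- Monotonicity in `p`: for `q ≤ u ≤ p ≤ p'`, `C(p+q, u)/C(p+q, q) ≤ C(p'+q, u)/C(p'+q, q)`. -/
theorem choose_div_choose_mono {p p' q u : ℕ} (hqu : q ≤ u) (hup : u ≤ p) (hpp : p ≤ p') :
    ((p + q).choose u : ℚ) / ((p + q).choose q : ℚ) ≤ ((p' + q).choose u : ℚ) / ((p' + q).choose q : ℚ) := by
  induction p' with
  | zero =>
    have : p = 0 := by omega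
    subst this; exact le_rfl
  | succ p' ih =>
    rcases Nat.lt_or_ge p (p' + 1) with hlt | hge
    · exact (ih (by omega)).trans (choose_div_choose_le_succ hqu)
    · have : p = p' + 1 := by omega
      subst this; exact le_rfl

variable {α : Type} [DecidableEq α]

/-- The price when the complement has rank `p ≥ u`, as a binomial quotient. -/
theorem price_eq_of_le {M : Matroid α} [M.Finite] {q u p : ℕ} {B : Finset α}
    (hB : M.eRk ((gr M \ B : Finset α) : Set α) = (p : ℕ∞)) (hup : u ≤ p) :
    Profile.price M q u B = ((p + q).choose u : ℚ) / ((p + q).choose q : ℚ) := by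
  unfold Profile.price
  rw [hB, ENat.toNat_coe, if_pos (by exact_mod_cast hup)]

/-- **Monotonicity of the price in the rank of the complement**: for two finite matroids (e.g. on the same ground),
if `ρ_M(E_M ∖ B) ≤ ρ_{M'}(E_{M'} ∖ B)` then `price_M(B) ≤ price_{M'}(B)` at every row `(q, u)` with `q ≤ u`. -/
theorem price_le_price_of_eRk_le {M M' : Matroid α} [M.Finite] [M'.Finite] {q u : ℕ}
    (hqu : q ≤ u) {B : Finset α}
    (hle : M.eRk ((gr M \ B : Finset α) : Set α) ≤ M'.eRk ((gr M' \ B : Finset α) : Set α)) :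
    Profile.price M q u B ≤ Profile.price M' q u B := by
  have hfin : M.eRk ((gr M \ B : Finset α) : Set α) ≠ ⊤ := by
    have := M.eRk_le_eRank ((gr M \ B : Finset α) : Set α)
    exact ne_top_of_le_ne_top (M.eRank_ne_top_iff.2 inferInstance) this
  have hfin' : M'.eRk ((gr M' \ B : Finset α) : Set α) ≠ ⊤ := by
    have := M'.eRk_le_eRank ((gr M' \ B : Finset α) : Set α)
    exact ne_top_of_le_ne_top (M'.eRank_ne_top_iff.2 inferInstance) this
  obtain ⟨p, hp⟩ : ∃ p : ℕ, M.eRk ((gr M \ B : Finset α) : Set α) = (p : ℕ∞) :=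
    ⟨_, (ENat.coe_toNat hfin).symm⟩
  obtain ⟨p', hp'⟩ : ∃ p' : ℕ, M'.eRk ((gr M' \ B : Finset α) : Set α) = (p' : ℕ∞) :=
    ⟨_, (ENat.coe_toNat hfin').symm⟩
  have hpp : p ≤ p' := by rw [hp, hp'] at hle; exact_mod_cast hle
  by_cases hup : u ≤ p
  · rw [price_eq_of_le hp hup, price_eq_of_le hp' (hup.trans hpp)]
    exact choose_div_choose_mono hqu hup hpp
  · have : Profile.price M q u B = 0 := by
      unfold Profile.price
      rw [hp, if_neg (by exact_mod_cast hup)]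
    rw [this]; exact Profile.price_nonneg _ _ _

/-- The price at level `u` is at least `(u+1)/(q+1)` when the complement has rank `≥ u+1`. -/
theorem div_le_price_of_succ_le_eRk {M : Matroid α} [M.Finite] {q u : ℕ} (hqu : q ≤ u) {B : Finset α}
    (hB : ((u + 1 : ℕ) : ℕ∞) ≤ M.eRk ((gr M \ B : Finset α) : Set α)) :
    ((u + 1 : ℕ) : ℚ) / ((q + 1 : ℕ) : ℚ) ≤ Profile.price M q u B := by
  have hfin : M.eRk ((gr M \ B : Finset α) : Set α) ≠ ⊤ := by
    have := M.eRk_le_eRank ((gr M \ B : Finset α) : Set α)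
    exact ne_top_of_le_ne_top (M.eRank_ne_top_iff.2 inferInstance) this
  obtain ⟨p, hp⟩ : ∃ p : ℕ, M.eRk ((gr M \ B : Finset α) : Set α) = (p : ℕ∞) :=
    ⟨_, (ENat.coe_toNat hfin).symm⟩
  have hup : u + 1 ≤ p := by rw [hp] at hB; exact_mod_cast hB
  rw [price_eq_of_le hp (by omega)]
  -- the value at `p = u+1` is `(u+1)/(q+1)`; then monotonicity
  have hbase : ((u + 1 + q).choose u : ℚ) / ((u + 1 + q).choose q : ℚ) = ((u + 1 : ℕ) : ℚ) / ((q + 1 : ℕ) : ℚ) := by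
    have h1 : (u + 1 + q).choose u = (u + 1 + q).choose (q + 1) := by
      have : u + 1 + q = u + (q + 1) := by ring
      rw [this, Nat.choose_symm_add]
    have h2 : (u + 1 + q).choose (q + 1) * (q + 1) = (u + 1 + q).choose q * (u + 1) := by
      have := Nat.choose_succ_right_eq (u + 1 + q) q
      rwa [show u + 1 + q - q = u + 1 by omega] at this
    have hpos : (0 : ℚ) < ((u + 1 + q).choose q : ℚ) := by exact_mod_cast Nat.choose_pos (by omega)
    rw [h1, div_eq_div_iff hpos.ne' (by positivity), mul_comm ((u + 1 : ℕ) : ℚ)]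
    exact_mod_cast h2
  rw [← hbase]
  exact choose_div_choose_mono hqu (by omega) hup

/-- The price at level `u` is at least `1` when the complement has rank `≥ u`. -/
theorem one_le_price_of_le_eRk {M : Matroid α} [M.Finite] {q u : ℕ} (hqu : q ≤ u) {B : Finset α}
    (hB : (u : ℕ∞) ≤ M.eRk ((gr M \ B : Finset α) : Set α)) : 1 ≤ Profile.price M q u B := by
  have hfin : M.eRk ((gr M \ B : Finset α) : Set α) ≠ ⊤ := by
    have := M.eRk_le_eRank ((gr M \ B : Finset α) : Set α)
    exact ne_top_of_le_ne_top (M.eRank_ne_top_iff.2 inferInstance) this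
  obtain ⟨p, hp⟩ : ∃ p : ℕ, M.eRk ((gr M \ B : Finset α) : Set α) = (p : ℕ∞) :=
    ⟨_, (ENat.coe_toNat hfin).symm⟩
  have hup : u ≤ p := by rw [hp] at hB; exact_mod_cast hB
  rw [price_eq_of_le hp hup]
  have hbase : ((u + q).choose u : ℚ) / ((u + q).choose q : ℚ) = 1 := by
    rw [Nat.choose_symm_add]
    exact div_self (by exact_mod_cast (Nat.choose_pos (by omega : q ≤ u + q)).ne')
  rw [← hbase]
  exact choose_div_choose_mono hqu le_rfl hup

end PriceMono

end PercRepro
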